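import Summits.Ventures.DiscreteObjects.Hadamard.ConferenceGraph333FixedBlockOrthogonal
import Summits.Ventures.DiscreteObjects.Hadamard.IntertwinedTraceBound

/-!
# The partial-Hadamard rank test at order `11` (kernel): an automorphism commuting with an element of order `11` fixes
# `t` orbits and `f_F` fixed vertices with `(t − f_F)² ≤ 9`

Framing: lottery ticket; floor = certified bounds/negative ranges.  Cell pub-namedobj (venture DiscreteObjects),
target (H) = `H(668)`, hadamard gen 31.  KERNEL INSTANCE of the new census tool (PAPER-SECTION-H-involutions-g31 §6; abstract core
`IntertwinedTraceBound.trace_sub_sq_le_of_intertwining`).  Let `ρ` have order `11` (so `F = Fix ρ` has `25` vertices and there are `28` orbits of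
size `11`, `ConferenceGraph333FixedBlockOrthogonal.aut_order11_fixed_block`), and let `σ` commute with `ρ`.  With `B_{y,O} = A_{y,x}` (`x ∈ O`; rows
`y ∈ F`, columns the `28` orbits) one has `B Bᵀ = 7(I + J)`, `K = (I − J/26)/7`, `B P = R B` for the permutation matrices `R` of `σ|_F` and `P` of
the action of `σ` on the orbits; hence
* **`aut_order11_commuting_rank_test`** — if `t₁₁ = #{x moved by ρ : σx ∈ ⟨ρ⟩x}` (`= 11·t`, `t` = number of `σ`-invariant `ρ`-orbits) and
  `f_F = #{x : σ x = x, ρ x = x}`, then `t₁₁ = 11 t` with `(t − f_F)² ≤ 9`.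
E2 consequences (code/rank_test_11_g31.py; the finer CHARACTER version is paper-level): with the census kit this bound removes 9 of the 16
admissible cycle types of order `22` (`#Fix` pattern `t − f_F ∈ {3, −1}` only) and is part of the order-`33`/`44`/`66` reductions.
WORDS: structure of a HYPOTHETICAL object (nothing about H(668) is excluded); ours (PROVISIONAL).  No `sorry`, no new definitions.
-/

namespace Summit.Ventures.DiscreteObjects.Hadamard

open Finset Matrix

section permMatrixTools
variable {α : Type*} [Fintype α] [DecidableEq α]

/-- the `0/1` matrix of a permutation `e`: `M_{ab} = [e a = b]`; it is orthogonal. -/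
theorem perm01_transpose_mul_self (e : Equiv.Perm α) :
    (Matrix.of fun a b : α => if e a = b then (1 : ℚ) else 0)ᵀ * (Matrix.of fun a b : α => if e a = b then (1 : ℚ) else 0) = 1 := by
  ext b b'
  simp only [Matrix.mul_apply, Matrix.transpose_apply, Matrix.of_apply, Matrix.one_apply]
  have e1 : ∀ a, (if e a = b then (1 : ℚ) else 0) * (if e a = b' then 1 else 0) = if a = e.symm b then (if b = b' then 1 else 0) else 0 := by
    intro a
    by_cases h : a = e.symm b
    · subst h; simp
    · have : e a ≠ b := fun h' => h (by rw [← h', Equiv.symm_apply_apply])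
      simp [this, h]
  rw [Finset.sum_congr rfl fun a _ => e1 a, Finset.sum_ite_eq' Finset.univ (e.symm b), if_pos (Finset.mem_univ _)]

/-- trace of the `0/1` matrix of `e` = number of fixed points. -/
theorem perm01_trace (e : Equiv.Perm α) :
    Matrix.trace (Matrix.of fun a b : α => if e a = b then (1 : ℚ) else 0) = ((univ.filter fun a => e a = a).card : ℚ) := by
  simp only [Matrix.trace, Matrix.diag_apply, Matrix.of_apply]
  rw [Finset.sum_boole]

/-- `M_e J = J` and `J M_e = J` for the all-ones matrix `J`. -/
theorem perm01_mul_allOnes (e : Equiv.Perm α) :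
    (Matrix.of fun a b : α => if e a = b then (1 : ℚ) else 0) * (Matrix.of fun _ _ : α => (1 : ℚ)) =
      (Matrix.of fun _ _ : α => (1 : ℚ)) ∧
    (Matrix.of fun _ _ : α => (1 : ℚ)) * (Matrix.of fun a b : α => if e a = b then (1 : ℚ) else 0) =
      (Matrix.of fun _ _ : α => (1 : ℚ)) := by
  constructor
  · ext a c
    simp only [Matrix.mul_apply, Matrix.of_apply, mul_one]
    rw [Finset.sum_ite_eq Finset.univ (e a), if_pos (Finset.mem_univ _)]
  · ext a c
    simp only [Matrix.mul_apply, Matrix.of_apply, one_mul]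
    have e1 : ∀ b, (if e b = c then (1 : ℚ) else 0) = if b = e.symm c then 1 else 0 := by
      intro b
      by_cases h : b = e.symm c
      · subst h; simp
      · have : e b ≠ c := fun h' => h (by rw [← h', Equiv.symm_apply_apply])
        simp [this, h]
    rw [Finset.sum_congr rfl fun b _ => e1 b, Finset.sum_ite_eq' Finset.univ (e.symm c), if_pos (Finset.mem_univ _)]

/-- `(M_e * X) a c = X (e a) c`. -/
theorem perm01_mul_left (e : Equiv.Perm α) {β : Type*} (X : Matrix α β ℚ) (a : α) (c : β) :
    ((Matrix.of fun a b : α => if e a = b then (1 : ℚ) else 0) * X) a c = X (e a) c := by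
  simp only [Matrix.mul_apply, Matrix.of_apply]
  have e1 : ∀ b, (if e a = b then (1 : ℚ) else 0) * X b c = if e a = b then X b c else 0 := fun b => by split_ifs <;> simp
  rw [Finset.sum_congr rfl fun b _ => e1 b, Finset.sum_ite_eq Finset.univ (e a), if_pos (Finset.mem_univ _)]

/-- `(Y * M_e) d a = Y d (e⁻¹ a)`. -/
theorem perm01_mul_right (e : Equiv.Perm α) {β : Type*} (Y : Matrix β α ℚ) (d : β) (a : α) :
    (Y * (Matrix.of fun a b : α => if e a = b then (1 : ℚ) else 0)) d a = Y d (e.symm a) := by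
  simp only [Matrix.mul_apply, Matrix.of_apply]
  have e1 : ∀ b, Y d b * (if e b = a then (1 : ℚ) else 0) = if b = e.symm a then Y d b else 0 := by
    intro b
    by_cases h : b = e.symm a
    · subst h; simp
    · have : e b ≠ a := fun h' => h (by rw [← h', Equiv.symm_apply_apply])
      simp [this, h]
  rw [Finset.sum_congr rfl fun b _ => e1 b, Finset.sum_ite_eq' Finset.univ (e.symm a), if_pos (Finset.mem_univ _)]

end permMatrixTools

section rankTest11
variable {V : Type*} [Fintype V] [DecidableEq V]

/-- **Partial-Hadamard rank test at order `11`.**  For `ρ` of order `11` and `σ` commuting with `ρ` (both automorphisms):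
`#{x : ρx ≠ x, σx ∈ ⟨ρ⟩x} = 11·t` with `(t − #{x : σ x = x ∧ ρ x = x})² ≤ 9`. -/
theorem aut_order11_commuting_rank_test (hV : Fintype.card V = 333) (A : Matrix V V ℤ)
    (h01 : ∀ x y, A x y = 0 ∨ A x y = 1) (hsymm : ∀ x y, A y x = A x y) (hdiag : ∀ x, A x x = 0)
    (hk : ∀ x, ∑ y, A x y = 166) (hsrg : ∀ x y, ∑ z, A x z * A z y = 83 * (1 + (if x = y then 1 else 0)) - A x y)
    (ρ : Equiv.Perm V) (hρ : ρ ^ 11 = 1) (hρ1 : ρ ≠ 1) (hAρ : ∀ x y, A (ρ x) (ρ y) = A x y)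
    (σ : Equiv.Perm V) (hc : σ * ρ = ρ * σ) (hAσ : ∀ x y, A (σ x) (σ y) = A x y) :
    ∃ t : ℕ, (univ.filter fun x => ρ x ≠ x ∧ σ x ∈ (Finset.range 11).image (fun k => (ρ ^ k) x)).card = 11 * t ∧
      ((t : ℤ) - (univ.filter fun x => σ x = x ∧ ρ x = x).card) ^ 2 ≤ 9 := by
  classical
  have hp : Nat.Prime 11 := by norm_num
  -- commuting facts on points
  have hcx : ∀ x, σ (ρ x) = ρ (σ x) := fun x => by
    have := congrArg (fun g : Equiv.Perm V => g x) hc; simpa using this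
  have hck : ∀ (k : ℕ) x, σ ((ρ ^ k) x) = (ρ ^ k) (σ x) := by
    intro k; induction k with
    | zero => intro x; simp
    | succ k ih => intro x; rw [pow_succ', Equiv.Perm.mul_apply, Equiv.Perm.mul_apply, hcx, ih]
  have hcinv : ∀ x, σ.symm (ρ x) = ρ (σ.symm x) := fun x => by
    apply σ.injective; rw [Equiv.apply_symm_apply, hcx, Equiv.apply_symm_apply]
  -- orbits of ρ
  set orb : V → Finset V := fun x => (Finset.range 11).image (fun k => (ρ ^ k) x) with horb
  have horb_mem : ∀ x y, y ∈ orb x ↔ orb y = orb x := fun x y => mem_orbP_iff ρ (by norm_num) hρ x y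
  have horb_self : ∀ x, x ∈ orb x := fun x => (horb_mem x x).mpr rfl
  have horb_pow : ∀ (k : ℕ) x, orb ((ρ ^ k) x) = orb x := fun k x =>
    (horb_mem x _).mp (Finset.mem_image.mpr ⟨k % 11, Finset.mem_range.mpr (Nat.mod_lt _ (by norm_num)),
      (perm_pow_apply_mod ρ hρ k x).symm⟩)
  have horb_card : ∀ x, ρ x ≠ x → (orb x).card = 11 := fun x hx => by
    simp only [horb]; rw [Finset.card_image_of_injOn (orbP_injOn ρ hp hρ x hx), Finset.card_range]
  have horb_moved : ∀ x, ρ x ≠ x → ∀ z ∈ orb x, ρ z ≠ z := by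
    intro x hx z hz h
    obtain ⟨k, -, rfl⟩ := Finset.mem_image.mp hz
    exact hx ((ρ ^ k).injective (by rw [perm_pow_apply_comm]; exact h))
  have horb_σ : ∀ x, orb (σ x) = (orb x).image σ := by
    intro x; simp only [horb]; rw [Finset.image_image]
    refine Finset.image_congr fun k _ => ?_
    show (ρ ^ k) (σ x) = (σ ∘ fun k => (ρ ^ k) x) k
    simp [hck]
  -- the orbit index type
  set S := (univ.filter fun x => ρ x ≠ x).image orb with hS
  set ι := {j : Finset V // j ∈ S} with hι
  have hrep : ∀ i : ι, ∃ x, ρ x ≠ x ∧ orb x = i.1 := fun i => by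
    obtain ⟨x, hx, hxe⟩ := Finset.mem_image.mp i.2
    exact ⟨x, (Finset.mem_filter.mp hx).2, hxe⟩
  choose rep hrep_moved hrep_orb using hrep
  have hrep_mem : ∀ i : ι, rep i ∈ i.1 := fun i => by rw [← hrep_orb i]; exact horb_self _
  -- fixed points as a subtype
  have hf25 := aut_order11_fixed hV A h01 hsymm hdiag hk hsrg ρ hρ hρ1 hAρ
  have hFcard : Fintype.card {y : V // ρ y = y} = 25 := by rw [Fintype.card_subtype, hf25]
  -- sums over the moved vertices = 11 · sums over orbit representatives, for orbit-invariant functions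
  have hdisj : Set.PairwiseDisjoint (↑(univ : Finset ι)) (fun i : ι => (i.1 : Finset V)) := by
    intro i _ i' _ hne
    show Disjoint i.1 i'.1
    rw [Finset.disjoint_left]
    intro z hz hz'
    apply hne; apply Subtype.ext
    rw [← hrep_orb i] at hz; rw [← hrep_orb i'] at hz'
    rw [← hrep_orb i, ← hrep_orb i', ← (horb_mem _ _).mp hz, ← (horb_mem _ _).mp hz']
  have hcover : (univ.filter fun x => ρ x ≠ x) = (univ : Finset ι).biUnion (fun i => i.1) := by
    ext z
    rw [Finset.mem_filter, Finset.mem_biUnion]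
    constructor
    · rintro ⟨-, hz⟩
      refine ⟨⟨orb z, Finset.mem_image.mpr ⟨z, Finset.mem_filter.mpr ⟨Finset.mem_univ _, hz⟩, rfl⟩⟩, Finset.mem_univ _, horb_self z⟩
    · rintro ⟨i, -, hz⟩
      rw [← hrep_orb i] at hz
      exact ⟨Finset.mem_univ _, horb_moved _ (hrep_moved i) z hz⟩
  have hsum : ∀ g : V → ℚ, (∀ x (k : ℕ), ρ x ≠ x → g ((ρ ^ k) x) = g x) →
      ∑ z ∈ univ.filter (fun x => ρ x ≠ x), g z = 11 * ∑ i : ι, g (rep i) := by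
    intro g hg
    rw [hcover, Finset.sum_biUnion hdisj, Finset.mul_sum]
    refine Finset.sum_congr rfl fun i _ => ?_
    rw [← hrep_orb i]
    simp only [horb]
    rw [Finset.sum_image (orbP_injOn ρ hp hρ (rep i) (hrep_moved i))]
    rw [Finset.sum_congr rfl fun k _ => hg (rep i) k (hrep_moved i), Finset.sum_const, Finset.card_range, nsmul_eq_mul]
    norm_num
  have hιcard : (Fintype.card ι : ℚ) = 28 := by
    have h1 := hsum (fun _ => 1) (fun _ _ _ => rfl)
    rw [Finset.sum_const, Finset.sum_const, Finset.card_univ, nsmul_eq_mul, nsmul_eq_mul, mul_one, mul_one] at h1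
    have hm : ((univ.filter fun x => ρ x ≠ x).card : ℚ) = 308 := by
      have h := Finset.card_filter_add_card_filter_not (s := (univ : Finset V)) (fun x => ρ x ≠ x)
      rw [Finset.card_univ, hV] at h
      have e : (univ.filter fun x => ¬ (ρ x ≠ x)) = univ.filter fun x => ρ x = x := Finset.filter_congr fun x _ => by simp
      rw [e, hf25] at h
      have : (univ.filter fun x => ρ x ≠ x).card = 308 := by omega
      exact_mod_cast this
    rw [hm] at h1
    linarith
  -- the induced permutations
  have hkey : ∀ y, ρ (σ y) = σ y ↔ ρ y = y := fun y => by
    constructor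
    · intro hy; rw [← hcx] at hy; exact σ.injective hy
    · intro hy; rw [← hcx, hy]
  set σF : Equiv.Perm {y : V // ρ y = y} := σ.subtypePerm hkey with hσF
  have hSperm : ∀ j : Finset V, j ∈ S ↔ σ.finsetCongr j ∈ S := by
    intro j
    rw [Equiv.finsetCongr_apply, Finset.map_eq_image]
    constructor
    · intro hj
      obtain ⟨x, hx, rfl⟩ := Finset.mem_image.mp hj
      have hxm := (Finset.mem_filter.mp hx).2
      refine Finset.mem_image.mpr ⟨σ x, Finset.mem_filter.mpr ⟨Finset.mem_univ _, fun h => hxm ?_⟩, ?_⟩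
      · rw [← hcx] at h; exact σ.injective h
      · show orb (σ x) = Finset.image (⇑σ.toEmbedding) (orb x)
        rw [horb_σ]; rfl
    · intro hj
      obtain ⟨x', hx', hxe⟩ := Finset.mem_image.mp hj
      have hx'm := (Finset.mem_filter.mp hx').2
      refine Finset.mem_image.mpr ⟨σ.symm x', Finset.mem_filter.mpr ⟨Finset.mem_univ _, fun h => hx'm ?_⟩, ?_⟩
      · have h2 := congrArg σ h
        rwa [hcx, Equiv.apply_symm_apply] at h2
      · have e1 : (orb (σ.symm x')).image σ = orb x' := by rw [← horb_σ, Equiv.apply_symm_apply]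
        have e2 : (orb (σ.symm x')).image σ = Finset.image (⇑σ.toEmbedding) j := by rw [e1, hxe]
        exact Finset.image_injective σ.injective e2
  set πσ : Equiv.Perm ι := Equiv.Perm.subtypePerm (σ.finsetCongr : Equiv.Perm (Finset V)) (fun j => (hSperm j).symm)
    with hπσ
  have hπσ_val : ∀ i : ι, (πσ i).1 = i.1.image σ := fun i => by
    show (σ.finsetCongr i.1) = i.1.image σ
    rw [Equiv.finsetCongr_apply, Finset.map_eq_image]; rfl
  have hσF_val : ∀ y : {y : V // ρ y = y}, (σF y).1 = σ y.1 := fun y => rfl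
  -- matrices
  set B : Matrix {y : V // ρ y = y} ι ℚ := fun y i => (A y.1 (rep i) : ℚ) with hB
  set Jm : Matrix {y : V // ρ y = y} {y : V // ρ y = y} ℚ := Matrix.of fun _ _ => (1 : ℚ) with hJm
  set K : Matrix {y : V // ρ y = y} {y : V // ρ y = y} ℚ := (1 / 7 : ℚ) • (1 - (1 / 26 : ℚ) • Jm) with hK
  set R : Matrix {y : V // ρ y = y} {y : V // ρ y = y} ℚ := Matrix.of fun a b => if σF a = b then (1 : ℚ) else 0 with hR
  set P : Matrix ι ι ℚ := Matrix.of fun a b => if πσ a = b then (1 : ℚ) else 0 with hP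
  -- row constancy on orbits (fixed rows)
  have hrow : ∀ (y : {y : V // ρ y = y}) (z : V) (k : ℕ), A y.1 ((ρ ^ k) z) = A y.1 z := fun y z k =>
    aut_fixed_row_orbit_constant A ρ hAρ y.2 z k
  -- B Bᵀ = 7 (1 + J)
  obtain ⟨hf', -, hblk1, hblk2, -⟩ := aut_order11_fixed_block hV A h01 hsymm hdiag hk hsrg ρ hρ hρ1 hAρ
  have hsdiff : (univ \ univ.filter fun x : V => ρ x = x) = univ.filter fun x => ρ x ≠ x := by
    ext z; simp
  have hBBt : B * Bᵀ = (7 : ℚ) • (1 + Jm) := by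
    ext y y'
    simp only [Matrix.mul_apply, Matrix.transpose_apply, hB, Matrix.smul_apply, Matrix.add_apply, Matrix.one_apply, hJm,
      Matrix.of_apply, smul_eq_mul]
    have hg := hsum (fun z => (A y.1 z : ℚ) * (A y'.1 z : ℚ)) (fun x k _ => by simp only [hrow])
    by_cases hyy : y = y'
    · subst hyy
      rw [if_pos rfl]
      have h154 : ∑ z ∈ univ.filter (fun x => ρ x ≠ x), (A y.1 z : ℚ) * (A y.1 z : ℚ) = 154 := by
        have e : ∀ z, (A y.1 z : ℚ) * (A y.1 z : ℚ) = (A y.1 z : ℚ) := fun z => by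
          rcases h01 y.1 z with h | h <;> simp [h]
        rw [Finset.sum_congr rfl fun z _ => e z, ← hsdiff]
        have := (hblk1 y.1 (Finset.mem_filter.mpr ⟨Finset.mem_univ _, y.2⟩)).1
        exact_mod_cast this
      rw [h154] at hg
      linarith
    · rw [if_neg hyy]
      have hne : y.1 ≠ y'.1 := fun h => hyy (Subtype.ext h)
      have h77 : ∑ z ∈ univ.filter (fun x => ρ x ≠ x), (A y.1 z : ℚ) * (A y'.1 z : ℚ) = 77 := by
        rw [← hsdiff]
        have := (hblk2 y.1 (Finset.mem_filter.mpr ⟨Finset.mem_univ _, y.2⟩) y'.1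
          (Finset.mem_filter.mpr ⟨Finset.mem_univ _, y'.2⟩) hne).1
        rw [Finset.sum_congr rfl fun z _ => by rw [hsymm z y'.1]]
        exact_mod_cast this
      rw [h77] at hg
      linarith
  -- J² = 25 J and B Bᵀ K = 1
  have hJJ : Jm * Jm = (25 : ℚ) • Jm := by
    ext a b
    simp only [Matrix.mul_apply, hJm, Matrix.of_apply, Matrix.smul_apply, smul_eq_mul, mul_one, Finset.sum_const,
      Finset.card_univ, nsmul_eq_mul]
    rw [hFcard]; norm_num
  have hJinv : (1 + Jm) * (1 - (1 / 26 : ℚ) • Jm) = 1 := by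
    rw [Matrix.add_mul, Matrix.one_mul, Matrix.mul_sub, Matrix.mul_one, Matrix.mul_smul, hJJ, smul_smul]
    ext a b
    simp only [Matrix.sub_apply, Matrix.add_apply, Matrix.one_apply, Matrix.smul_apply, hJm, Matrix.of_apply, smul_eq_mul]
    split_ifs <;> norm_num
  have hBK : B * Bᵀ * K = 1 := by
    rw [hBBt, hK, Matrix.smul_mul, Matrix.mul_smul, smul_smul, hJinv]
    norm_num
  have hJt : Jmᵀ = Jm := by ext a b; rfl
  have hKt : Kᵀ = K := by
    rw [hK, Matrix.transpose_smul, Matrix.transpose_sub, Matrix.transpose_one, Matrix.transpose_smul, hJt]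
  -- orthogonality, J-compatibility
  have hRtR : Rᵀ * R = 1 := by rw [hR]; exact perm01_transpose_mul_self σF
  have hPtP : Pᵀ * P = 1 := by rw [hP]; exact perm01_transpose_mul_self πσ
  have hRK : R * K = K * R := by
    obtain ⟨hRJ, hJR⟩ := perm01_mul_allOnes σF
    rw [hK, Matrix.mul_smul, Matrix.smul_mul, Matrix.mul_sub, Matrix.sub_mul, Matrix.mul_one, Matrix.one_mul,
      Matrix.mul_smul, Matrix.smul_mul, hR, hJm, hRJ, hJR]
  -- intertwining B P = R B
  have hBP : B * P = R * B := by
    ext y j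
    rw [hP, perm01_mul_right πσ B y j, hR, perm01_mul_left σF B y j]
    simp only [hB, hσF_val]
    -- rep (πσ.symm j) is sent by σ into the orbit of rep j
    set i₀ := πσ.symm j with hi₀
    have hval : (πσ i₀).1 = j.1 := by rw [hi₀, Equiv.apply_symm_apply]
    rw [hπσ_val] at hval
    have hmem : σ (rep i₀) ∈ orb (rep j) := by
      rw [hrep_orb j, ← hval]; exact Finset.mem_image_of_mem _ (hrep_mem i₀)
    obtain ⟨k, -, hk'⟩ := Finset.mem_image.mp hmem
    -- A y (rep i₀) = A (σ y) (σ rep i₀) = A (σ y) (ρ^k rep j) = A (σ y) (rep j)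
    have e1 : A y.1 (rep i₀) = A (σ y.1) (σ (rep i₀)) := (hAσ y.1 (rep i₀)).symm
    rw [e1, ← hk']
    have hσy : ρ (σ y.1) = σ y.1 := by rw [← hcx, y.2]
    exact_mod_cast aut_fixed_row_orbit_constant A ρ hAρ hσy (rep j) k
  -- the abstract bound
  have hmain := trace_sub_sq_le_of_intertwining B K hBK hKt R P hRtR hPtP hRK hBP
  rw [hιcard, hFcard, hR, hP, perm01_trace, perm01_trace] at hmain
  -- identify the traces
  have htrR : ((univ.filter fun a : {y : V // ρ y = y} => σF a = a).card : ℤ) = (univ.filter fun x => σ x = x ∧ ρ x = x).card := by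
    have e : (univ.filter fun a : {y : V // ρ y = y} => σF a = a).card = (univ.filter fun x => σ x = x ∧ ρ x = x).card := by
      rw [← Fintype.card_subtype, ← Fintype.card_subtype]
      refine Fintype.card_congr ⟨fun a => ⟨a.1.1, ?_, a.1.2⟩, fun x => ⟨⟨x.1, x.2.2⟩, ?_⟩, fun a => rfl, fun x => rfl⟩
      · have := congrArg Subtype.val a.2; rwa [hσF_val] at this
      · exact Subtype.ext ((hσF_val _).trans x.2.1)
    exact_mod_cast e
  set t := (univ.filter fun a : ι => πσ a = a).card with ht
  refine ⟨t, ?_, ?_⟩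
  · -- t₁₁ = 11 t
    have hg := hsum (fun z => if σ z ∈ orb z then (1 : ℚ) else 0) (fun x k hx => by
      show (if σ ((ρ ^ k) x) ∈ orb ((ρ ^ k) x) then (1 : ℚ) else 0) = if σ x ∈ orb x then 1 else 0
      rw [horb_pow, hck]
      have : (ρ ^ k) (σ x) ∈ orb x ↔ σ x ∈ orb x := by
        rw [horb_mem, horb_mem, horb_pow]
      simp only [this])
    rw [Finset.sum_boole, Finset.sum_boole, Finset.filter_filter] at hg
    have hfix : (univ.filter fun i : ι => σ (rep i) ∈ orb (rep i)) = univ.filter fun a : ι => πσ a = a := by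
      refine Finset.filter_congr fun i _ => ?_
      rw [horb_mem, horb_σ, hrep_orb, ← hπσ_val]
      constructor
      · intro h; exact Subtype.ext h
      · intro h; rw [h]
    rw [hfix, ← ht] at hg
    have : ((univ.filter fun x => ρ x ≠ x ∧ σ x ∈ orb x).card : ℚ) = 11 * t := by exact_mod_cast hg
    exact_mod_cast this
  · rw [← htrR]
    have h' : ((t : ℚ) - ((univ.filter fun a : {y : V // ρ y = y} => σF a = a).card : ℚ)) ^ 2 ≤ 9 := by
      have := hmain; norm_num at this ⊢; linarith
    have h'' : (((t : ℤ) - ((univ.filter fun a : {y : V // ρ y = y} => σF a = a).card : ℤ)) ^ 2 : ℤ) ≤ 9 := by exact_mod_cast h'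
    exact h''

end rankTest11

end Summit.Ventures.DiscreteObjects.Hadamard
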